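import Mathlib
import Literature.Analysis.FluidPDE.PoincareBall
import Literature.Analysis.FluidPDE.SuitableWeakRescaling
import Literature.Analysis.FluidPDE.SereginSverakPressureProofs
import Literature.Analysis.FluidPDE.BlowupFarField
import Literature.Analysis.FluidPDE.SereginSverak2002VertexBlowupLimit
import Literature.Analysis.FluidPDE.NSSuitableESS
import Literature.Analysis.FluidPDE.ESSLocalHolderHolds
import Literature.Analysis.FluidPDE.ESSLocalHolderBlowupLimit
import Literature.Analysis.FluidPDE.LocalTypeIScaling
import Literature.Analysis.FluidPDE.LocalTypeIPersistenceHolds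
import Literature.Analysis.FluidPDE.LocalTypeICongr
import Literature.Analysis.FluidPDE.LeraySuitableWeakSolutions
import Literature.Analysis.FluidPDE.NSWeakStrongUniquenessHolds
import Literature.Analysis.FluidPDE.TaoLocalisationHolds
import Literature.Analysis.FluidPDE.TaoLocalisationProofs
import Literature.Analysis.FluidPDE.KatoMaximalTimeSingular
import Literature.Analysis.FluidPDE.TypeIRateScaledEnergyBound
import Literature.Analysis.FluidPDE.SereginSverak2002PressureLowerBoundProofs
import Literature.Analysis.FluidPDE.NSLerayHopfABCScaling
import Literature.Analysis.FluidPDE.NSTimeRescaleClassical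
import Literature.Analysis.FluidPDE.NSViscosityRescaling
import Literature.Analysis.FluidPDE.TypeIAncientMildRescale
import Literature.Analysis.FluidPDE.SelfSimilar
import Literature.Analysis.FluidPDE.AncientAxisymmetricTypeILiouville
import Literature.Analysis.FluidPDE.CKNLocalEnergyEstimate
import Literature.Analysis.FluidPDE.CKNPressureEstimate
import Literature.Analysis.FluidPDE.CKNUnforcedOneScaleRRS
import Literature.Analysis.FluidPDE.CKNLocalRegularityRRSPressure
import Literature.Analysis.FluidPDE.RusinSverakSingularityStabilityEpsilon
import Literature.Analysis.FluidPDE.CKNScalingExtras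
import Literature.Analysis.FluidPDE.CKNLocalRegularityRRSStep3
import Literature.Analysis.FluidPDE.PineauVicolOneSliceProofs
import Literature.Analysis.FluidPDE.TsaiLocalEnergyProofs
import Summits.NavierStokesRegularity.NavierStokesRegularity.Theorems.TypeIQuarterGateScarEnvelopeTypeIRateFloorEngines
import Summits.NavierStokesRegularity.NavierStokesRegularity.Theorems.TypeIQuarterGateScarEnvelopeTypeIRateFloorConstants
import Summits.NavierStokesRegularity.NavierStokesRegularity.Theorems.TypeIQuarterGateScarEnvelopeTypeIRateFloor
import Summits.NavierStokesRegularity.NavierStokesRegularity.Theorems.TypeIQuarterGateScarEnvelopeTypeISatelliteTowerDefs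
import Summits.NavierStokesRegularity.NavierStokesRegularity.Theorems.TypeIQuarterGateScarEnvelopeTypeISatelliteTowerObjects
import Summits.NavierStokesRegularity.NavierStokesRegularity.Theorems.TypeIQuarterGateScarEnvelopeTypeISatelliteTowerRootRateDefs
import Summits.NavierStokesRegularity.NavierStokesRegularity.Theorems.TypeIQuarterGateScarEnvelopeTypeISatelliteTowerRateLadder
import Summits.NavierStokesRegularity.NavierStokesRegularity.Theorems.TypeIQuarterGateScarEnvelopeTypeISatelliteTowerRootCensus
import Summits.NavierStokesRegularity.NavierStokesRegularity.Theorems.TypeIQuarterGateScarEnvelopeTypeISatelliteTowerRateMinimal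

/-!
# Satellite tower for crux `ScarEnvelopeTypeI` (stmt-NavierStokesRegularity-23843) — Part O6–O7: the floor in the A–B class; Part N's small-rate hypothesis DISCHARGED on bounded sub-classes

Part O6–O7 of the ROUND-35 plate (section `FloorAB`): ★ `ABTower.regPt_of_rateAt` (an A–B tower object with `𝐈 ≤ I` and
local rate `≤ ε ≤ ε_*(I)` at a final-time point is regular there), `SmallRateRegularityB` / `smallRateRegularityB_epsFloor`
(Part N's `SmallRateRegularity` DISCHARGED on every sub-class `𝐈 ≤ I`), `ABTower.epsFloor_le_tightRate`, `ABTower.regPt_or_gap`,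
`rootRate_trapB` (N4's trap along bounded chains without the print hypothesis), `singRatesB` and `epsFloor_le_sInf_singRatesB`.

PROVENANCE: declaration texts VERBATIM from the HOME plate of the instrument seat nsreg-p3 g26 (cell
`pub/ns-regularity-ideate`): `round-35/Tangent35prep.lean` v9 (sha16 `ce6f8ea4cb093fca`; = ROUND-34 plate v8
`84f56c3bc8f4da24` VERBATIM + Part O), scored PASS by referee ref3 g26 (`SCORE-p3-ROUND-35-0828.md`); the author cannot
write under `Theorems/` (`perm.theorems-prover-only`); landed by the prover ns-es-p1 g5 as landing hand of record
(director-ns DIRECTOR-NS #237 (3)), split into ≤ 400-line modules, namespace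
`Summit.NavierStokesRegularity.NavierStokesRegularity.Cruxes.ScarEnvelopeTypeI.ZoomDictionary.Floor` for the plate's `NsregP3.R35O` (and `Summit.NavierStokesRegularity.NavierStokesRegularity.Cruxes.ScarEnvelopeTypeI.ZoomDictionary`
for its `NsregP3.R30P`, as in the 26 landed dictionary / satellite-tower modules), `E3` spelled out, one-line
docstrings added where the plate had none.  `--supports stmt-NavierStokesRegularity-23843 --as helper`.

HONEST FRAMING: an effective ε-regularity INSTRUMENT inside the Type-I box, proved from the tree's CKN engines
(`localEnergy_master`, `pressureEstimate_holds`, `RRS2016.theorem15_3_holds`) — no compactness, no Liouville theorem,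
no hypothesis taken from print; it bears on the crux `TypeIQuarterGate.ScarEnvelopeTypeI` (item 23843) only through the
satellite-tower census (Part N's `SmallRateRegularity` hypothesis is discharged on bounded sub-classes).  NO open
statement is proved — 23843, its parent `QuarterLawTypeI`, the route and Navier–Stokes regularity are OPEN.
-/

-- the summit-side namespace repeats a component by design (single-conjunct summit, D-0017)
set_option linter.dupNamespace false

open MeasureTheory Set Metric Filter Topology
open scoped ENNReal NNReal InnerProductSpace
open Literature.Analysis.FluidPDE
open Summit.NavierStokesRegularity.NavierStokesRegularity.Cruxes.ScarEnvelopeTypeI.ZoomDictionary.Floor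

namespace Summit.NavierStokesRegularity.NavierStokesRegularity.Cruxes.ScarEnvelopeTypeI.ZoomDictionary

variable {U : ℝ → (EuclideanSpace ℝ (Fin 3)) → (EuclideanSpace ℝ (Fin 3))} {P : ℝ → (EuclideanSpace ℝ (Fin 3)) → ℝ}

section FloorAB

/-- `A(r; z) ≤ abScaledSum r z U P` (the Albritton–Barker scaled sum dominates the CKN energy quantity). -/
theorem cknAEss_le_abScaledSum' (r : ℝ) (z : ℝ × (EuclideanSpace ℝ (Fin 3))) (U : ℝ → (EuclideanSpace ℝ (Fin 3)) → (EuclideanSpace ℝ (Fin 3))) (P : ℝ → (EuclideanSpace ℝ (Fin 3)) → ℝ)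
    (H : ℝ → (EuclideanSpace ℝ (Fin 3)) → (EuclideanSpace ℝ (Fin 3)) →L[ℝ] (EuclideanSpace ℝ (Fin 3))) : cknAEss r z U ≤ abScaledSum r z U P H := by
  rw [abScaledSum]
  calc cknAEss r z U ≤ cknAEss r z U + cknC r z U := le_self_add
    _ ≤ cknAEss r z U + cknC r z U + cknDOsc r z P := le_self_add
    _ ≤ cknAEss r z U + cknC r z U + cknDOsc r z P + cknE r z H := le_self_add

/-- `E(r; z) ≤ abScaledSum r z U P` with the Fréchet-derivative gradient field. -/
theorem cknE_le_abScaledSum' (r : ℝ) (z : ℝ × (EuclideanSpace ℝ (Fin 3))) (U : ℝ → (EuclideanSpace ℝ (Fin 3)) → (EuclideanSpace ℝ (Fin 3))) (P : ℝ → (EuclideanSpace ℝ (Fin 3)) → ℝ)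
    (H : ℝ → (EuclideanSpace ℝ (Fin 3)) → (EuclideanSpace ℝ (Fin 3)) →L[ℝ] (EuclideanSpace ℝ (Fin 3))) : cknE r z H ≤ abScaledSum r z U P H := by
  rw [abScaledSum]; exact le_add_self

/-- `Q_a(0) ⊆ (-∞, 0] × ℝ³` (as the product set `Iic 0 ×ˢ univ`). -/
theorem parabolicCylinder_zero_subset_lowerHalf (a : ℝ) :
    parabolicCylinder a (0 : ℝ × (EuclideanSpace ℝ (Fin 3))) ⊆ Iio (0 : ℝ) ×ˢ (univ : Set (EuclideanSpace ℝ (Fin 3))) := by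
  intro w hw
  rw [mem_parabolicCylinder] at hw
  exact ⟨by simpa using hw.1.2, mem_univ _⟩

/-- **O6a ★ (THE FLOOR for A–B objects).**  An Albritton–Barker object with `𝐈(ℝ³ × ℝ₋) ≤ I`
whose velocity has a Type-I rate `≤ ε` near the final-time point `(0, y')` (N2 `RateAt`), with
`0 ≤ ε ≤ ε_*(I)` (`NsregP3.R35O.epsFloor`, explicit in `I` and the tree's CKN constants), is
regular at `(0, y')`. -/
theorem ABTower.regPt_of_rateAt {M I ε : ℝ} {H : ℝ → (EuclideanSpace ℝ (Fin 3)) → (EuclideanSpace ℝ (Fin 3)) →L[ℝ] (EuclideanSpace ℝ (Fin 3))} (hT : ABTower M U P H)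
    (hI : typeIBound (Iio (0 : ℝ) ×ˢ univ) U P H ≤ ENNReal.ofReal I) {y' : (EuclideanSpace ℝ (Fin 3))}
    (hr : RateAt ε U y') (hε0 : 0 ≤ ε) (hε : ε ≤ epsFloor I) : RegPt U y' := by
  obtain ⟨-, hIB, hH, -⟩ := hT
  obtain ⟨δ, hδ, hrate⟩ := hr
  set a : ℝ := ‖y'‖ + 2 with ha
  have hapos : 0 < a := by rw [ha]; positivity
  obtain ⟨hsuit, -, -, hP⟩ := hIB a hapos
  have hQle : (parabolicCylinderOpens a (0 : ℝ × (EuclideanSpace ℝ (Fin 3))) : TopologicalSpace.Opens (ℝ × (EuclideanSpace ℝ (Fin 3)))) ≤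
      slab (EuclideanSpace ℝ (Fin 3)) (Iio 0) isOpen_Iio := fun w hw => parabolicCylinder_zero_subset_lowerHalf a hw
  have hH' := hH.mono hQle
  -- shrink the rate window to `δ' = min δ 1`
  set δ' : ℝ := min δ 1 with hδ'
  have hδ'pos : 0 < δ' := lt_min hδ one_pos
  have hrate' : ∀ t ∈ Ioo (-δ' ^ 2) 0, ∀ x ∈ ball y' δ', Real.sqrt (-t) * ‖U t x‖ ≤ ε := by
    intro t ht x hx
    have h1 : δ' ≤ δ := min_le_left _ _
    have h2 : δ' ^ 2 ≤ δ ^ 2 := by nlinarith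
    exact hrate t ⟨by linarith [ht.1], ht.2⟩ x (ball_subset_ball h1 hx)
  -- `A, E ≤ 𝐈 ≤ I` on every sub-ball
  have hA : ∀ r > 0, ∀ z, parabolicCylinder r z ⊆ parabolicCylinder a (0 : ℝ × (EuclideanSpace ℝ (Fin 3))) →
      cknAEss r z U ≤ ENNReal.ofReal I := fun r hr z hz =>
    ((cknAEss_le_abScaledSum' r z U P H).trans
      (abScaledSum_le_typeIBound hr (hz.trans (parabolicCylinder_zero_subset_lowerHalf a)))).trans hI
  have hE : ∀ r > 0, ∀ z, parabolicCylinder r z ⊆ parabolicCylinder a (0 : ℝ × (EuclideanSpace ℝ (Fin 3))) →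
      cknE r z H ≤ ENNReal.ofReal I := fun r hr z hz =>
    ((cknE_le_abScaledSum' r z U P H).trans
      (abScaledSum_le_typeIBound hr (hz.trans (parabolicCylinder_zero_subset_lowerHalf a)))).trans hI
  -- `P ∈ L^{3/2}(Q_a(0))`
  have hDfin : ∫⁻ w in parabolicCylinder a (0 : ℝ × (EuclideanSpace ℝ (Fin 3))), ‖P w.1 w.2‖ₑ ^ (3 / 2 : ℝ) ≠ ⊤ := by
    have hlt := hP.eLpNorm_lt_top
    rw [eLpNorm_lt_top_iff_lintegral_rpow_enorm_lt_top (by norm_num)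
      (ENNReal.div_ne_top (by norm_num) (by norm_num))] at hlt
    have e : (3 / 2 : ℝ≥0∞).toReal = 3 / 2 := by rw [ENNReal.toReal_div]; norm_num
    rw [e] at hlt
    exact hlt.ne
  obtain ⟨ρ, hρ, K, hK⟩ := floor hδ'pos (min_le_right _ _) (le_of_eq ha.symm) hsuit hH' hA hE hDfin
    hrate' hε0 hε
  exact ⟨ρ, hρ, K, hK⟩

/-- Part N's small-rate regularity on the `𝐈`-BOUNDED sub-class `𝐈 ≤ I`. -/
def SmallRateRegularityB (M I ε : ℝ) : Prop :=
  ∀ (U : ℝ → (EuclideanSpace ℝ (Fin 3)) → (EuclideanSpace ℝ (Fin 3))) (P : ℝ → (EuclideanSpace ℝ (Fin 3)) → ℝ) (H : ℝ → (EuclideanSpace ℝ (Fin 3)) → (EuclideanSpace ℝ (Fin 3)) →L[ℝ] (EuclideanSpace ℝ (Fin 3))), ABTower M U P H →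
    typeIBound (Iio (0 : ℝ) ×ˢ univ) U P H ≤ ENNReal.ofReal I →
    ∀ y' : (EuclideanSpace ℝ (Fin 3)), RateAt ε U y' → RegPt U y'

/-- **O6b ★ (N4's hypothesis DISCHARGED on bounded sub-classes, with the explicit floor).** -/
theorem smallRateRegularityB_epsFloor (M I : ℝ) : SmallRateRegularityB M I (epsFloor I) :=
  fun _ _ _ hT hI _ hr => hT.regPt_of_rateAt hI hr (epsFloor_pos I).le le_rfl

/-- Monotonicity in `ε`. -/
theorem SmallRateRegularityB.mono {M I ε ε' : ℝ} (h : SmallRateRegularityB M I ε) (hε : ε' ≤ ε) :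
    SmallRateRegularityB M I ε' :=
  fun U P H hT hI y' hr => h U P H hT hI y' (hr.mono hε)

/-- **O6c ★ (THE FLOOR OF THE RATE LADDER, per object).**  At a SINGULAR final-time point of an
A–B object with `𝐈 ≤ I`, the tight Type-I rate is at least `ε_*(I)`. -/
theorem ABTower.epsFloor_le_tightRate {M I : ℝ} {H : ℝ → (EuclideanSpace ℝ (Fin 3)) → (EuclideanSpace ℝ (Fin 3)) →L[ℝ] (EuclideanSpace ℝ (Fin 3))} (hT : ABTower M U P H)
    (hI : typeIBound (Iio (0 : ℝ) ×ˢ univ) U P H ≤ ENNReal.ofReal I) {y' : (EuclideanSpace ℝ (Fin 3))}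
    (hy : ¬ RegPt U y') : epsFloor I ≤ tightRate U y' := by
  by_contra hlt
  exact hy (hT.regPt_of_rateAt hI
    ((towerObj_of_abTower hT).rateAt_of_tightRate_lt (lt_of_not_ge hlt)) (epsFloor_pos I).le le_rfl)

/-- **O6d (contrapositive reading: a quantitative gap).**  On an A–B object with `𝐈 ≤ I`, every
final-time point is either regular or carries the rate gap `tightRate ≥ ε_*(I)`: there is NO
singular point with a small Type-I profile constant. -/
theorem ABTower.regPt_or_gap {M I : ℝ} {H : ℝ → (EuclideanSpace ℝ (Fin 3)) → (EuclideanSpace ℝ (Fin 3)) →L[ℝ] (EuclideanSpace ℝ (Fin 3))} (hT : ABTower M U P H)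
    (hI : typeIBound (Iio (0 : ℝ) ×ˢ univ) U P H ≤ ENNReal.ofReal I) (y' : (EuclideanSpace ℝ (Fin 3))) :
    RegPt U y' ∨ epsFloor I ≤ tightRate U y' := by
  by_cases hy : RegPt U y'
  · exact Or.inl hy
  · exact Or.inr (hT.epsFloor_le_tightRate hI hy)

/-! ### O7. The floor on `𝐈`-bounded chains and sub-classes -/

/-- **O7a ★ (the trap with its floor, on `𝐈`-bounded root descents).**  Part N's `rootRate_trap`
with the hypothesis `SmallRateRegularity` REPLACED by a uniform bound `𝐈 ≤ I` along the chain: the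
root rates decrease to a limit `m_∞ ≥ ε_*(I) > 0`. -/
theorem rootRate_trapB {M I : ℝ} {c : ℕ → TNode}
    (hc : ∀ k, RootObj M (c k) ∧ ¬ TameRoot (c k) ∧ RootDescends (c k) (c (k + 1)))
    (hI : ∀ k, typeIBound (Iio (0 : ℝ) ×ˢ univ) (c k).U (c k).P (c k).H ≤ ENNReal.ofReal I) :
    ∃ m : ℝ, m ∈ Icc (epsFloor I) M ∧ Antitone (fun k => tightRate (c k).U 0) ∧
      (∀ k, tightRate (c k).U 0 ∈ Icc m M) ∧
      Tendsto (fun k => tightRate (c k).U 0) atTop (𝓝 m) := by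
  obtain ⟨m, hm, hle, ht⟩ := rootRate_tendsto hc
  have hε : ∀ k, epsFloor I ≤ tightRate (c k).U 0 := fun k =>
    (hc k).1.1.epsFloor_le_tightRate (hI k) (hc k).1.2
  exact ⟨m, ⟨ge_of_tendsto' ht hε, hm.2⟩, rootRate_antitone hc,
    fun k => ⟨hle k, (rootRate_mem_Icc hc k).2⟩, ht⟩

/-- The singular rates realised in the sub-class `𝐈 ≤ I`. -/
def singRatesB (M I : ℝ) : Set ℝ :=
  {r | ∃ (U : ℝ → (EuclideanSpace ℝ (Fin 3)) → (EuclideanSpace ℝ (Fin 3))) (P : ℝ → (EuclideanSpace ℝ (Fin 3)) → ℝ) (H : ℝ → (EuclideanSpace ℝ (Fin 3)) → (EuclideanSpace ℝ (Fin 3)) →L[ℝ] (EuclideanSpace ℝ (Fin 3))) (y : (EuclideanSpace ℝ (Fin 3))),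
    ABTower M U P H ∧ typeIBound (Iio (0 : ℝ) ×ˢ univ) U P H ≤ ENNReal.ofReal I ∧
      ¬ RegPt U y ∧ r = tightRate U y}

/-- `singRatesB M I ⊆ singRates M`. -/
theorem singRatesB_subset (M I : ℝ) : singRatesB M I ⊆ singRates M :=
  fun _ ⟨U, P, H, y, hAB, _, hy, hr⟩ => ⟨U, P, H, y, hAB, hy, hr⟩

/-- **O7b ★ (A POSITIVE FLOOR UNDER EVERY `𝐈`-BOUNDED SUB-CLASS).**  Every singular rate realised by
an A–B object with `𝐈 ≤ I` is at least `ε_*(I)`; in particular the sub-class minimal singular rate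
`inf singRatesB M I` is `≥ ε_*(I) > 0` whenever the sub-class has a scar. -/
theorem epsFloor_le_of_mem_singRatesB {M I r : ℝ} (hr : r ∈ singRatesB M I) : epsFloor I ≤ r := by
  obtain ⟨U, P, H, y, hAB, hI, hy, rfl⟩ := hr
  exact hAB.epsFloor_le_tightRate hI hy

/-- On the sub-class `𝐈 ≤ I` the infimum of the singular tight rates is at least the floor `ε_*(I)`. -/
theorem epsFloor_le_sInf_singRatesB {M I : ℝ} (hne : (singRatesB M I).Nonempty) :
    epsFloor I ≤ sInf (singRatesB M I) :=
  le_csInf hne fun _ hr => epsFloor_le_of_mem_singRatesB hr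

/-- On the sub-class `𝐈 ≤ I` the infimum of the singular tight rates is positive. -/
theorem sInf_singRatesB_pos {M I : ℝ} (hne : (singRatesB M I).Nonempty) :
    0 < sInf (singRatesB M I) :=
  (epsFloor_pos I).trans_le (epsFloor_le_sInf_singRatesB hne)

end FloorAB

end Summit.NavierStokesRegularity.NavierStokesRegularity.Cruxes.ScarEnvelopeTypeI.ZoomDictionary
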